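import Mathlib
import HarnessLib
import Summits.Parity.GeneralizedHardyLittlewood.Theses.ScaleTauberianCarving

/-!
# Route `ScaleTauberianCarving`, glue item `UpperGlue` (stmt-Parity-31401): the finite Tauberian exchange, upper side

decomp-parity node G1.2.T «ScaleTauberianCarving» (lens-6 g6; critic CLEARED HOME/STATUS.md l.316, CRITIC-LEDGER
row 63; route born rev 0, commit 71d4b4a7eaf4).  `UpperGlue` is `LogWindowHL → ScaleRigidity → FixedUpper` (the
record's stmt-Parity-26852 text verbatim behind the two new hypotheses).  The proof is the cell kernel's
(`HOME/decomp-parity-lens-6/g6/hand/ScaleTauberianCarvingKernel.lean`, `fixedAt_of_pieces` ∘ `window_core_abs`)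
written WITHOUT auxiliary definitions, directly on the born texts: if on the scale window `(N, N²]` every
normalised error `err(n)/n^d` of a dilate is within `ε` of `err(N)/N^d` (piece B, evaluated only at
`n ∈ (N, N²]`) and the logarithmically weighted window mean of the `err(n)/n^d` is at most `ε` in size (piece A
with `M = N²`), then `|err(N)/N^d| ≤ 3ε`.  The two-sided conclusion `twoSided_of_pieces` is recorded so that the
lower glue (stmt-Parity-31402) is a one-line corollary.  Hand by the cell's prover-class seat (census-1 g8).
-/

open scoped BigOperators
open Finset Literature.NumberTheory.Sieve

namespace Summit.Parity.GeneralizedHardyLittlewood.Theses.ScaleTauberianCarving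

/-- Core of the exchange (one-sided): if every term `g n`, `n ∈ (N, M]`, of a non-empty window is within `ε` of
`a` and the logarithmically weighted window mean of `g` is at most `ε` in size, then `a ≤ 3ε`.  (Folklore: a
window all of whose terms exceed `2ε` has weighted mean `> ε`.) -/
theorem window_core {g : ℕ → ℝ} {a ε : ℝ} {N M : ℕ} (hε : 0 < ε) (hNM : N < M)
    (hA : |∑ n ∈ Ioc N M, g n / n| ≤ ε * ∑ n ∈ Ioc N M, (1 : ℝ) / n)
    (hB : ∀ n ∈ Ioc N M, |a - g n| ≤ ε) : a ≤ 3 * ε := by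
  by_contra h
  rw [not_le] at h
  set S := ∑ n ∈ Ioc N M, (1 : ℝ) / n with hS_def
  have hS : 0 < S := by
    apply Finset.sum_pos
    · intro n hn
      have : 0 < n := lt_of_le_of_lt (Nat.zero_le N) (Finset.mem_Ioc.mp hn).1
      positivity
    · exact ⟨M, Finset.mem_Ioc.mpr ⟨hNM, le_rfl⟩⟩
  have hterm : ∀ n ∈ Ioc N M, 2 * ε * ((1 : ℝ) / n) ≤ g n / n := by
    intro n hn
    have hn0 : (0 : ℝ) < n := by
      exact_mod_cast lt_of_le_of_lt (Nat.zero_le N) (Finset.mem_Ioc.mp hn).1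
    have h1 : 2 * ε ≤ g n := by
      have := (abs_sub_le_iff.mp (hB n hn)).1
      linarith
    rw [div_eq_mul_one_div (g n) (n : ℝ)]
    exact mul_le_mul_of_nonneg_right h1 (by positivity)
  have hsum : 2 * ε * S ≤ ∑ n ∈ Ioc N M, g n / n := by
    rw [hS_def, Finset.mul_sum]
    exact Finset.sum_le_sum hterm
  have hle := le_abs_self (∑ n ∈ Ioc N M, g n / n)
  have hεS : 0 < ε * S := mul_pos hε hS
  nlinarith

/-- Core of the exchange (two-sided): under the hypotheses of `window_core`, `|a| ≤ 3ε` (apply the one-sided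
core to `g` and to `-g`). (Folklore.) -/
theorem window_core_abs {g : ℕ → ℝ} {a ε : ℝ} {N M : ℕ} (hε : 0 < ε) (hNM : N < M)
    (hA : |∑ n ∈ Ioc N M, g n / n| ≤ ε * ∑ n ∈ Ioc N M, (1 : ℝ) / n)
    (hB : ∀ n ∈ Ioc N M, |a - g n| ≤ ε) : |a| ≤ 3 * ε := by
  have h₁ : a ≤ 3 * ε := window_core hε hNM hA hB
  have hA' : |∑ n ∈ Ioc N M, (-g n) / n| ≤ ε * ∑ n ∈ Ioc N M, (1 : ℝ) / n := by
    have : ∑ n ∈ Ioc N M, (-g n) / n = -∑ n ∈ Ioc N M, g n / n := by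
      rw [← Finset.sum_neg_distrib]
      exact Finset.sum_congr rfl fun n _ => by rw [neg_div]
    rw [this, abs_neg]
    exact hA
  have hB' : ∀ n ∈ Ioc N M, |(-a) - (-g n)| ≤ ε := by
    intro n hn
    rw [neg_sub_neg, abs_sub_comm]
    exact hB n hn
  have h₂ : -a ≤ 3 * ε := window_core hε hNM hA' hB'
  exact abs_le.mpr ⟨by linarith, h₁⟩

/-- **The finite Tauberian exchange, two-sided, on the born texts**: `LogWindowHL` and `ScaleRigidity` give, for
every `d, t ≥ 1`, every non-degenerate system `Ψ` and every `ε > 0`, eventually in `N` and uniformly over convex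
`K ⊆ [-N,N]^d`, the two-sided fixed-pattern Hardy–Littlewood bound
`|∑_{K∩ℤ^d} ∏ Λ(ψᵢ(n)) − β_∞ 𝔖| ≤ ε N^d`.  Piece B is evaluated only at `n ∈ (N, N²]`, piece A only at
`M = N²`. (This node; kernel `fixedAt_of_pieces`.) -/
theorem twoSided_of_pieces (hA : LogWindowHL) (hB : ScaleRigidity) :
    ∀ (d t : ℕ), 1 ≤ d → 1 ≤ t → ∀ Ψ : Fin t → AffLinForm d, IsNondegenerateSystem Ψ → ∀ ε : ℝ, 0 < ε →
      ∃ N₀ : ℕ, ∀ N : ℕ, N₀ ≤ N → ∀ K : Set (Fin d → ℝ), Convex ℝ K → K ⊆ realBox d N →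
        |vonMangoldtSum Ψ K N - archFactor Ψ K * singularProduct Ψ| ≤ ε * (N : ℝ) ^ d := by
  intro d t hd ht Ψ hΨ ε hε
  obtain ⟨NA, hNA⟩ := hA d t hd ht Ψ hΨ (ε / 3) (by positivity)
  obtain ⟨NB, hNB⟩ := hB d t hd ht Ψ hΨ (ε / 3) (by positivity)
  refine ⟨max (max NA NB) 2, fun N hN K hK hKN => ?_⟩
  have hNA' : NA ≤ N := le_trans (le_trans (le_max_left _ _) (le_max_left _ _)) hN
  have hNB' : NB ≤ N := le_trans (le_trans (le_max_right _ _) (le_max_left _ _)) hN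
  have h2 : 2 ≤ N := le_trans (le_max_right _ _) hN
  have hNM : N < N ^ 2 := by
    rw [pow_two]
    exact lt_mul_of_one_lt_right (by omega) (by omega)
  have hNd : (0 : ℝ) < (N : ℝ) ^ d := by positivity
  have key := window_core_abs
    (g := fun n => (vonMangoldtSum Ψ ((fun x : Fin d → ℝ => ((n : ℝ) / (N : ℝ)) • x) '' K) n -
      archFactor Ψ ((fun x : Fin d → ℝ => ((n : ℝ) / (N : ℝ)) • x) '' K) * singularProduct Ψ) / (n : ℝ) ^ d)
    (a := (vonMangoldtSum Ψ K N - archFactor Ψ K * singularProduct Ψ) / (N : ℝ) ^ d)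
    (by positivity : 0 < ε / 3) hNM (hNA N hNA' (N ^ 2) le_rfl K hK hKN)
    (fun n hn => hNB N hNB' n (le_of_lt (Finset.mem_Ioc.mp hn).1) (Finset.mem_Ioc.mp hn).2 K hK hKN)
  rw [abs_div, abs_of_pos hNd, div_le_iff₀ hNd] at key
  have h3 : 3 * (ε / 3) * (N : ℝ) ^ d = ε * (N : ℝ) ^ d := by ring
  linarith

/-- **`UpperGlue` holds** (stmt-Parity-31401): `LogWindowHL → ScaleRigidity → FixedUpper` — the upper half of
the two-sided exchange `twoSided_of_pieces`. -/
theorem upperGlue_holds : UpperGlue := by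
  intro hA hB d t hd ht Ψ hΨ ε hε
  obtain ⟨N₀, hN₀⟩ := twoSided_of_pieces hA hB d t hd ht Ψ hΨ ε hε
  exact ⟨N₀, fun N hN K hK hKN => (abs_le.mp (hN₀ N hN K hK hKN)).2⟩

end Summit.Parity.GeneralizedHardyLittlewood.Theses.ScaleTauberianCarving
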